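import Literature.AlgebraicTopology.SingularHomology.PoincareDualityClosed
import Literature.AlgebraicTopology.SingularHomology.OrientationProofs
import Literature.AlgebraicTopology.SingularHomology.UniversalCoefficientsField
import Literature.AlgebraicTopology.SingularHomology.UniverseTransportIso
import Literature.Topology.FourManifolds.HomotopyS4CompactProofs
import Mathlib.Topology.Instances.Shrink
import Mathlib.Algebra.Field.ZMod
import HarnessLib

/-!
# Mod-2 Poincaré duality for closed manifolds: `H_q(X; ℤ/2) = 0 ⇒ H_p(X; ℤ/2) = 0`, `p + q = n`

A. Hatcher, *Algebraic Topology* (2002), §3.3: every closed topological `n`-manifold is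
`ℤ/2`-orientable (p. 235) and satisfies Poincaré duality `Hᵖ(X; ℤ/2) ≅ H_{n-p}(X; ℤ/2)`
(Thm. 3.30); with the universal coefficient theorem over the field `ℤ/2` (Thm. 3.2 / p. 198,
`Hᵖ ≅ Hom(H_p, ℤ/2)`), the mod-`2` Betti numbers are symmetric. This file records the vanishing
form of that symmetry for closed manifolds `X : Type u` in every universe, everything else being
proved in the tree:

* `isZero_singularHomology_zmodTwo_of_isZero_of_add_eq_of_type` — for `X : Type`: from
  `isOrientableOver_zmod_two_holds` (`ℤ/2`-orientation), `bijective_poincareDualityMap_of_one_le`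
  (duality, `PoincareDualityClosed.lean`) and `kroneckerPairing_bijective_of_field` (universal
  coefficients over a field);
* `isZero_singularHomology_zmodTwo_of_isZero_of_add_eq` — for `X : Type u` second countable,
  through `Shrink.{0} X` (`small_of_secondCountableTopology`, `singularHomology.isZero_iff_of_homeomorph`).

Used with `n = 4`, `(p, q) = (1, 3)` in the homology computation of the Manolescu–Piccirillo
manifold (`ZeroSurgeryHomotopyBallSliceProofs.lean`): `H₃(X; ℤ/2) = 0 ⇒ H₁(X; ℤ/2) = 0`.
Everything is proved; no named facts, no definitions.

## References

* A. Hatcher, *Algebraic Topology*, CUP 2002, §3.3 p. 235, Thm. 3.30; §3.1 Thm. 3.2, p. 198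
  [HatcherAT2002].
-/

noncomputable section

open CategoryTheory Limits Set Function
open Literature.AlgebraicTopology.SingularHomology

universe u

namespace Literature.Topology.FourManifolds

/-- **Mod-2 duality of vanishing, universe `0`**: for a closed topological `n`-manifold
`X : Type` (`n ≥ 1`) and `q + p = n`, `H_q(X; ℤ/2) = 0` implies `H_p(X; ℤ/2) = 0`:
`Hom(H_q, ℤ/2) = 0`, so `H^q(X; ℤ/2) = 0` by universal coefficients over the field `ℤ/2`
(`kroneckerPairing_bijective_of_field`), and `H_p ≅ H^q` by Poincaré duality for the
`ℤ/2`-orientation (`isOrientableOver_zmod_two_holds`, `bijective_poincareDualityMap_of_one_le`).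
[cite: HatcherAT2002, Thm. 3.30 and §3.3 p. 235] -/
theorem isZero_singularHomology_zmodTwo_of_isZero_of_add_eq_of_type {X : Type} [TopologicalSpace X]
    [T2Space X] [CompactSpace X] {n : ℕ} [ChartedSpace (EuclideanSpace ℝ (Fin n)) X] (hn : 1 ≤ n)
    {p q : ℕ} (h : q + p = n) (hq : IsZero (singularHomology (ZMod 2) (ZMod 2) X q)) :
    IsZero (singularHomology (ZMod 2) (ZMod 2) X p) := by
  haveI : Fact (Nat.Prime 2) := ⟨Nat.prime_two⟩
  obtain ⟨μ⟩ : IsOrientableOver (ZMod 2) X n := isOrientableOver_zmod_two_holds X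
  have hPD := bijective_poincareDualityMap_of_one_le hn μ h
  -- `H^q(X; ℤ/2) = 0`
  haveI := ModuleCat.subsingleton_of_isZero hq
  have hcoh : ∀ a : singularCohomology (ZMod 2) (ZMod 2) X q, a = 0 := by
    intro a
    apply (kroneckerPairing_bijective_of_field (ZMod 2) X q).1
    ext c
    rw [Subsingleton.elim c 0, map_zero, map_zero]
  rw [ModuleCat.isZero_iff_subsingleton]
  refine ⟨fun x y => ?_⟩
  obtain ⟨a, rfl⟩ := hPD.2 x
  obtain ⟨b, rfl⟩ := hPD.2 y
  rw [hcoh a, hcoh b]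

/-- **Mod-2 duality of vanishing**: for a closed (compact, Hausdorff, second countable)
topological `n`-manifold `X : Type u`, `n ≥ 1`, and `q + p = n`, `H_q(X; ℤ/2) = 0` implies
`H_p(X; ℤ/2) = 0` (the universe-`0` statement transported along `X ≃ₜ Shrink.{0} X`).
[cite: HatcherAT2002, Thm. 3.30 and §3.3 p. 235] -/
theorem isZero_singularHomology_zmodTwo_of_isZero_of_add_eq {X : Type u} [TopologicalSpace X]
    [T2Space X] [CompactSpace X] [SecondCountableTopology X] {n : ℕ}
    [ChartedSpace (EuclideanSpace ℝ (Fin n)) X] (hn : 1 ≤ n) {p q : ℕ} (h : q + p = n)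
    (hq : IsZero (singularHomology (ZMod 2) (ZMod 2) X q)) :
    IsZero (singularHomology (ZMod 2) (ZMod 2) X p) := by
  haveI : Small.{0} X := small_of_secondCountableTopology X
  let φ : X ≃ₜ Shrink.{0} X := Shrink.homeomorph X
  haveI : T2Space (Shrink.{0} X) := φ.t2Space
  haveI : CompactSpace (Shrink.{0} X) := φ.compactSpace
  letI : ChartedSpace X (Shrink.{0} X) := φ.symm.toOpenPartialHomeomorph.singletonChartedSpace rfl
  letI : ChartedSpace (EuclideanSpace ℝ (Fin n)) (Shrink.{0} X) :=
    ChartedSpace.comp (EuclideanSpace ℝ (Fin n)) X (Shrink.{0} X)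
  have hq' : IsZero (singularHomology (ZMod 2) (ZMod 2) (Shrink.{0} X) q) :=
    (singularHomology.isZero_iff_of_homeomorph (ZMod 2) (ZMod 2) φ q).1 hq
  exact (singularHomology.isZero_iff_of_homeomorph (ZMod 2) (ZMod 2) φ p).2
    (isZero_singularHomology_zmodTwo_of_isZero_of_add_eq_of_type hn h hq')

end Literature.Topology.FourManifolds
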